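import Literature.NumberTheory.GaloisRepresentations.HomDualCovariantSequence
import Literature.NumberTheory.GaloisRepresentations.HomDualIdeleReadout
import Literature.NumberTheory.GaloisRepresentations.HomDualShaTwoObstruction
import Literature.NumberTheory.GaloisCohomology.PoitouTateSha
import HarnessLib

/-!
# The NATIVE degree-`2` obstruction map `Ψ = H²(e⁻¹) ∘ δ₁^{Hom(S, K̄ˣ)} ∘ δ₀^{Hom(N₁, T)} : Hom_{C_Γ}(N₁, C̄) → H²(K, M^D)`
# of the presentation road (Milne ADT I Thm. 4.10 (a)), with FOUR of its five properties — including the local one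

Topic `NumberTheory/GaloisRepresentations`; namespace `Literature.NumberTheory.GaloisRepresentations.HomDual`.
Definitions with bodies and theorems; no named fact, no instance, no `sorry`.  Sequel of
`HomDualCovariantSequence` (`isSES_hom`, `postcomp`, `IsSES.map_res_δ₁`, `IsSES.map_res_δ₀_eq_zero_of_extends`),
`HomDualIdeleReadout` (door-c6: `IdeleProjection`, `readout`), `HomDualPresentation` (`isSES_dual`), `HomDualReadoutLocal`
/ `HomDualReadoutRestrict` (`tateDualUnitsIso`, `tateDualRestrictUnitsIso`), `PresentationGaloisModules` (`toDGM`, `pres_isSES`)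
and `GalLayerSystemSES` (door-c5: `0 → lim→ Eˣ → J̄ → C̄ → 0`).

THE MATHEMATICS.  `K` a number field, `n ≥ 1`, `ρ` a finite discrete `n`-torsion `Γ_K`-module on `M`, with door-c4's
presentation `S : 0 → N₁ → P → M → 0` (`P = ℤ[Γ_K/U_{K(M)}]^{|M|}`, `N₁` a lattice) and door-c5's idèle class sequence
`T : 0 → K̄ˣ → J̄ → C̄ → 0` (first term `lim→ Eˣ ≅ K̄ˣ`, `unitsBarAddEquiv`).  Since `N₁` is `ℤ`-free,
`Hom(N₁, T) : 0 → Hom(N₁, K̄ˣ) → Hom(N₁, J̄) → Hom(N₁, C̄) → 0` is short exact (`isSES_hom`); since `K̄ˣ` is divisible,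
`Hom(S, K̄ˣ) : 0 → Hom(M, K̄ˣ) → Hom(P, K̄ˣ) → Hom(N₁, K̄ˣ) → 0` is short exact (`isSES_dual`).  The NATIVE obstruction map is
**`shaTwoConnecting ρ n hM : Hom_{C_Γ}(N₁, C̄) →+ H²(K, M^D)`**,
`h ↦ H²(e⁻¹)(δ₁^{Hom(S, K̄ˣ)}(δ₀^{Hom(N₁, T)}(h)))` with `e = tateDualUnitsIso : M^D ≅ Hom_ℤ(M, K̄ˣ)` — the composite of
the two connecting maps of continuous cochains (`IsSES.δ₀`, `IsSES.δ₁`), i.e. Milne's `Ext¹(M, C̄) → Ext²(M, K̄ˣ) = H²(K, M^D)`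
computed at the level of homomorphisms out of the relation lattice, up to the universal sign.  Properties:
* (a) `shaTwoConnecting_comp_g` : `Ψ(f ≫ g) = 0` for `f : N₁ ⟶ J̄` (exactness of `δ₀` at `Hom_Γ(N₁, C̄)`);
* (b) `shaTwoConnecting_f_comp` : `Ψ(ι ≫ q) = 0` for `q : P ⟶ C̄` (naturality of `δ₀` under `Hom(P, T) → Hom(N₁, T)` and
  `δ₁ ∘ H¹(ι^*) = 0`);
* (c) `exists_comp_g_eq_of_shaTwoConnecting_eq_zero` : `Ψ h = 0 ⟹ h = f ≫ g` (exactness of `δ₁` at `H¹(Hom(N₁, K̄ˣ))` plus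
  `H¹(K, Hom(P, K̄ˣ)) = 0`, door-c6 `HomPermutation.galoisCohomology_hom_units_eq_zero`, then exactness of `δ₀`);
* (d) **`localization_shaTwoConnecting_eq_zero`** : `loc_v (Ψ h) = 0` at EVERY place `v` carrying an idèle projection
  `π_v : J̄ → K̄_vˣ` (door-c6 `IdeleProjection`): `δ₁` commutes with restriction-and-transfer (`IsSES.map_res_δ₁`), and the
  restricted-and-transferred `δ₀^{Hom(N₁, T)}(h)` is the coboundary of `π_v ∘ h̃` for a lift `h̃ : N₁ → J̄` of `h`
  (`IsSES.map_res_δ₀_eq_zero_of_extends`: `π_v` extends `ι_v : K̄ˣ → K̄_vˣ` over `J̄`); hence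
  **`shaTwoConnecting_mem_shaTwo`** : `Ψ h ∈ Ш²(K, M^D)` given idèle projections at all places.
The fifth property (e) `Ш²(K, M^D) ⊆ Im Ψ` (Brauer–Hasse–Noether for `K(M)` + `Ш¹` of `Hom(N₁, J̄)`) is NOT proved here.
HONEST FRAMING: no case of Poitou–Tate or BSD is proved here.

## References
* J. S. Milne, *Arithmetic Duality Theorems* (2nd ed. 2006), I §0 (0.8), I Thm. 4.10 (a) (proof, p. 58), Lemma 4.13.
  [MilneADT2006]
* J. Neukirch, A. Schmidt, K. Wingberg, *Cohomology of Number Fields* (2008), (1.3.2), (1.3.3), (1.5.2).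
  [NeukirchSchmidtWingberg2008]
* J. W. S. Cassels, A. Fröhlich (eds.), *Algebraic Number Theory* (1967), Ch. VII §8, §9.7, §11.1. [CasselsFrohlichANT1967]
-/

noncomputable section

open CategoryTheory CategoryTheory.Limits NumberField
open Field (absoluteGaloisGroup)
open scoped ContRepresentation

namespace Literature.NumberTheory.GaloisRepresentations

namespace HomDual

open Literature.Algebra.Homology Literature.Algebra.Homology.DiscreteRep DiscreteGaloisModule IdeleClassBar
  FreePresentation DGMBridge HomPermutation

/-! ## §1 The idèle class sequence `0 → K̄ˣ → J̄ → C̄ → 0` as a native short exact sequence with first term `units K` -/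

section IdeleClass

variable (K : Type) [Field K] [NumberField K]

/-- **`K̄ˣ → J̄`** (principal idèles), natively: `unitsBarAddEquiv⁻¹` followed by door-c5's `lim (Eˣ → J_E)`, as a continuous
equivariant map `units K → toDGM J̄`. [cite: CasselsFrohlichANT1967, Ch. VII §8] -/
def unitsToIdeleI : (units K).toContRepresentation →ⁱL (toDGM (ideleBarD K)).toContRepresentation where
  toLinearMap := ((LCarrier.of (ideleBarD K)).comp (((unitsToIdele K).limitMap).comp
    (unitsBarAddEquiv K).symm.toAddMonoidHom)).toIntLinearMap
  cont := continuous_of_discreteTopology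
  isIntertwining' σ := by
    refine ContinuousLinearMap.ext fun u => ?_
    obtain ⟨z, rfl⟩ := (unitsBarAddEquiv K).surjective u
    change LCarrier.of (ideleBarD K) ((unitsToIdele K).limitMap ((unitsBarAddEquiv K).symm (units K σ (unitsBarAddEquiv K z)))) =
      toDGM (ideleBarD K) σ (LCarrier.of (ideleBarD K) ((unitsToIdele K).limitMap ((unitsBarAddEquiv K).symm (unitsBarAddEquiv K z))))
    rw [← unitsBarAddEquiv_rep, AddEquiv.symm_apply_apply, AddEquiv.symm_apply_apply, (unitsToIdele K).limitMap_rep,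
      toDGM_apply, LCarrier.val_of]

/-- Unfolding `unitsToIdeleI`. [cite: CasselsFrohlichANT1967, Ch. VII §8] -/
@[simp] theorem unitsToIdeleI_apply (u : UnitsCarrier K) :
    unitsToIdeleI K u = LCarrier.of (ideleBarD K) ((unitsToIdele K).limitMap ((unitsBarAddEquiv K).symm u)) := rfl

/-- **`J̄ → C̄`** (idèle classes), natively: door-c5's `lim (J_E → C_E)` on the `toDGM` synonyms.
[cite: CasselsFrohlichANT1967, Ch. VII §8] -/
abbrev ideleToClassI : (toDGM (ideleBarD K)).toContRepresentation →ⁱL (toDGM (classBarD K)).toContRepresentation :=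
  lmap (ideleBarD K) (classBarD K) (ideleClassSeq K).g

/-- **`0 → K̄ˣ → J̄ → C̄ → 0` is a native short exact sequence of discrete Galois modules** (door-c5's
`ideleClassLimitShortComplex_shortExact` in element form, first term transported along `unitsBarAddEquiv`).
[cite: CasselsFrohlichANT1967, Ch. VII §8 and §11.1] -/
theorem idele_isSES :
    IsSES (toTopRepHom (units K) (toDGM (ideleBarD K)) (unitsToIdeleI K))
      (toTopRepHom (toDGM (ideleBarD K)) (toDGM (classBarD K)) (ideleToClassI K)) where
  comp_eq_zero := by
    apply TopRep.hom_ext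
    rw [TopRep.hom_comp, TopRep.hom_zero]
    refine DFunLike.ext _ _ fun u => ?_
    change LCarrier.of (classBarD K) ((ideleClassSeq K).g.hom.hom
      ((ideleClassLimitShortComplex K).f.hom.hom ((unitsBarAddEquiv K).symm u))) = 0
    rw [shortComplex_g_f_apply (ideleClassSeq K)]
    rfl
  injective := fun u u' h => (unitsBarAddEquiv K).symm.injective (unitsToIdele_limitMap_injective K h)
  exact_mid := fun y hy => by
    obtain ⟨w, hw⟩ := exists_unitsToIdele_limitMap_eq K (LCarrier.val (ideleBarD K) y) hy
    exact ⟨unitsBarAddEquiv K w, by rw [unitsToIdeleI, toTopRepHom]; change LCarrier.of _ ((unitsToIdele K).limitMap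
      ((unitsBarAddEquiv K).symm (unitsBarAddEquiv K w))) = y; rw [AddEquiv.symm_apply_apply, hw]; rfl⟩
  surjective := fun c => by
    obtain ⟨y, hy⟩ := ideleToClass_limitMap_surjective K (LCarrier.val (classBarD K) c)
    exact ⟨LCarrier.of (ideleBarD K) y, hy⟩

end IdeleClass

/-! ## §2 The relation module `N₁` and the free module `P` of the presentation are projective lattices -/

section Lattice

variable {K : Type} [Field K] [NumberField K]
variable {M : Type} [AddCommGroup M] [TopologicalSpace M] [DiscreteTopology M] [Finite M]
variable (ρ : DiscreteGaloisModule K M)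

/-- `P = ℤ[Γ_K/U]^{|M|}` is `ℤ`-free (its permuted basis). [cite: MilneADT2006, I Lemma 1.9 (proof)] -/
theorem free_presModule₂ : Module.Free ℤ (LCarrier (presentationComplex ρ).X₂) :=
  Module.Free.of_basis (presModuleBasis ρ)

/-- **`N₁` is `ℤ`-free** (a finitely generated subgroup of the free `P`, over the PID `ℤ`). [cite: MilneADT2006, I Lemma 1.9 (proof)] -/
theorem free_presModule₁ : Module.Free ℤ (LCarrier (presentationComplex ρ).X₁) := by
  haveI := moduleFinite_presModule₁ ρ
  haveI := free_presModule₂ ρ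
  haveI : Module.IsTorsionFree ℤ (LCarrier (presentationComplex ρ).X₁) :=
    Function.Injective.moduleIsTorsionFree (presIncl ρ).toContinuousLinearMap.toLinearMap
      (fun a b h => (pres_isSES ρ).injective h) (fun c x => map_zsmul _ c x)
  exact Module.free_of_finite_type_torsion_free'

/-- `N₁` is a projective `ℤ`-module. [cite: MilneADT2006, I Lemma 1.9 (proof)] -/
theorem projective_presModule₁ : Module.Projective ℤ (LCarrier (presentationComplex ρ).X₁) := by
  haveI := free_presModule₁ ρ
  infer_instance

/-- `P` is a projective `ℤ`-module. [cite: MilneADT2006, I Lemma 1.9 (proof)] -/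
theorem projective_presModule₂ : Module.Projective ℤ (LCarrier (presentationComplex ρ).X₂) := by
  haveI := free_presModule₂ ρ
  infer_instance

end Lattice

/-! ## §3 `C_Γ`-morphisms into `J̄`, `C̄` as invariants of the `Hom`-modules, and back -/

section Invariants

variable {K : Type} [Field K]
variable (X : DiscreteRepCat ℤ (absoluteGaloisGroup K)) [Module.Finite ℤ (LCarrier X)] (Y : DiscreteRepCat ℤ (absoluteGaloisGroup K))

/-- A `C_Γ`-morphism `u : X ⟶ Y` as an invariant of `Hom_ℤ(X, Y)` (on the `toDGM` synonyms). [cite: MilneADT2006, I §0 (0.8)] -/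
def homInvariant (u : X ⟶ Y) : (homGaloisModule (toDGM X) (toDGM Y)).toTopRep.ρ.invariants :=
  invariantOfEquivariant _ _ (lmap X Y u).toContinuousLinearMap.toLinearMap (fun σ x => lmapAddHom_smul X Y u σ x)

/-- Unfolding `homInvariant`. [cite: MilneADT2006, I §0 (0.8)] -/
@[simp] theorem coe_homInvariant_apply (u : X ⟶ Y) (x : LCarrier X) :
    (show LCarrier X →ₗ[ℤ] LCarrier Y from ((homInvariant X Y u).1 : DiscreteRep.HomCarrier (LCarrier X) (LCarrier Y))) x =
      LCarrier.of Y (u.hom.hom (LCarrier.val X x)) := rfl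

/-- **`u ↦ homInvariant u` is additive.** [cite: MilneADT2006, I §0 (0.8)] -/
def homInvariantHom : (X ⟶ Y) →+ (homGaloisModule (toDGM X) (toDGM Y)).toTopRep.ρ.invariants where
  toFun := homInvariant X Y
  map_zero' := Subtype.ext (LinearMap.ext fun _ => rfl)
  map_add' _ _ := Subtype.ext (LinearMap.ext fun _ => rfl)

/-- Unfolding `homInvariantHom`. [cite: MilneADT2006, I §0 (0.8)] -/
@[simp] theorem homInvariantHom_apply (u : X ⟶ Y) : homInvariantHom X Y u = homInvariant X Y u := rfl

-- As in `PresentationGaloisModules` (DGMBridge): on the vectors `X.obj.V` of an object of `Rep ℤ Γ` the representation's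
-- own `Module ℤ` structure `Rep.hV2` must be the preferred one while building an intertwining map (no library instance is
-- overridden: `Rep.hV2` is a structure field, made a local instance for this one definition only).
attribute [local instance 10000] Rep.hV2 in
/-- **An equivariant additive map `LCarrier X → LCarrier Y` as a `C_Γ`-morphism `X ⟶ Y`** (inverse to `lmap`; the two
`ℤ`-module structures on the vectors agree, `map_intCast_smul`). [cite: SerreGaloisCohomology1997, I §2.1] -/
def homOfEquivariant (w : LCarrier X →+ LCarrier Y) (hw : ∀ (σ : absoluteGaloisGroup K) (x : LCarrier X),
    w (toDGM X σ x) = toDGM Y σ (w x)) : X ⟶ Y :=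
  ObjectProperty.homMk (Rep.ofHom (ρ := X.obj.ρ) (σ := Y.obj.ρ)
    ⟨{ toFun := fun x => LCarrier.val Y (w (LCarrier.of X x))
       map_add' := fun x y => by rw [map_add, map_add, map_add]
       map_smul' := fun c x => map_intCast_smul ((LCarrier.val Y).comp (w.comp (LCarrier.of X))) ℤ ℤ c x },
      fun σ => LinearMap.ext fun x => hw σ (LCarrier.of X x)⟩)

omit [Module.Finite ℤ (LCarrier X)] in
/-- Unfolding `homOfEquivariant` on vectors. [cite: SerreGaloisCohomology1997, I §2.1] -/
@[simp] theorem homOfEquivariant_hom_apply (w : LCarrier X →+ LCarrier Y)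
    (hw : ∀ (σ : absoluteGaloisGroup K) (x : LCarrier X), w (toDGM X σ x) = toDGM Y σ (w x)) (x : X.obj.V) :
    (homOfEquivariant X Y w hw).hom.hom x = LCarrier.val Y (w (LCarrier.of X x)) := rfl

end Invariants

/-! ## §4 The native obstruction map and properties (a), (b), (c) -/

section Obstruction

variable {K : Type} [Field K] [NumberField K]
variable {M : Type} [AddCommGroup M] [TopologicalSpace M] [DiscreteTopology M] [Finite M]
variable (ρ : DiscreteGaloisModule K M) (n : ℕ) (hM : ∀ m : M, n • m = 0)

/-- **`Hom(N₁, T) : 0 → Hom(N₁, K̄ˣ) → Hom(N₁, J̄) → Hom(N₁, C̄) → 0` is short exact** (`N₁` is a projective lattice).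
[cite: MilneADT2006, I Thm. 4.10 (proof, p. 58)] -/
theorem hom_idele_isSES :
    haveI := moduleFinite_presModule₁ ρ
    IsSES (homF (presModule₁ ρ) (units K) (toDGM (ideleBarD K)) (unitsToIdeleI K))
      (homG (presModule₁ ρ) (toDGM (ideleBarD K)) (toDGM (classBarD K)) (ideleToClassI K)) := by
  haveI := moduleFinite_presModule₁ ρ
  haveI := projective_presModule₁ ρ
  exact isSES_hom (presModule₁ ρ) (units K) (toDGM (ideleBarD K)) (toDGM (classBarD K)) (unitsToIdeleI K) (ideleToClassI K)
    (idele_isSES K)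

/-- **`Hom(P, T) : 0 → Hom(P, K̄ˣ) → Hom(P, J̄) → Hom(P, C̄) → 0` is short exact** (`P` is free).
[cite: MilneADT2006, I Thm. 4.10 (proof, p. 58)] -/
theorem hom_idele_isSES₂ :
    haveI := moduleFinite_presModule₂ ρ
    IsSES (homF (presModule₂ ρ) (units K) (toDGM (ideleBarD K)) (unitsToIdeleI K))
      (homG (presModule₂ ρ) (toDGM (ideleBarD K)) (toDGM (classBarD K)) (ideleToClassI K)) := by
  haveI := moduleFinite_presModule₂ ρ
  haveI := projective_presModule₂ ρ
  exact isSES_hom (presModule₂ ρ) (units K) (toDGM (ideleBarD K)) (toDGM (classBarD K)) (unitsToIdeleI K) (ideleToClassI K)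
    (idele_isSES K)

/-- **`Hom(S, K̄ˣ) : 0 → Hom(M, K̄ˣ) → Hom(P, K̄ˣ) → Hom(N₁, K̄ˣ) → 0` is short exact** (`K̄ˣ` is divisible; door-c6
`isSES_dual` at the canonical presentation). [cite: MilneADT2006, I §0 (0.8), I Lemma 4.13 (proof)] -/
theorem dual_pres_isSES :
    haveI := moduleFinite_presModule₁ ρ
    haveI := moduleFinite_presModule₂ ρ
    IsSES (dualF (presModule₂ ρ) ρ (units K) (presProj ρ)) (dualG (presModule₁ ρ) (presModule₂ ρ) (units K) (presIncl ρ)) := by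
  haveI := moduleFinite_presModule₁ ρ
  haveI := moduleFinite_presModule₂ ρ
  exact isSES_dual (presModule₁ ρ) (presModule₂ ρ) ρ (units K) (presIncl ρ) (presProj ρ) (pres_isSES ρ) (baer_unitsCarrier K)

/-- **THE NATIVE degree-`2` obstruction map `Ψ : Hom_{C_Γ}(N₁, C̄) →+ H²(K, M^D)`**,
`h ↦ H²(e⁻¹)(δ₁^{Hom(S, K̄ˣ)}(δ₀^{Hom(N₁, T)}(h)))`, `e = tateDualUnitsIso : M^D ≅ Hom_ℤ(M, K̄ˣ)` — the composite of the
native connecting maps `δ₀` of `Hom(N₁, T)` and `δ₁` of `Hom(S, K̄ˣ)` (Milne's `Ext¹(M, C̄) → Ext²(M, K̄ˣ) = H²(K, M^D)` on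
homomorphisms out of the relation lattice, up to the universal sign). [cite: MilneADT2006, I Thm. 4.10 (proof, p. 58)]
[cite: NeukirchSchmidtWingberg2008, (1.3.2)] -/
def shaTwoConnecting : ((presentationComplex ρ).X₁ ⟶ classBarD K) →+ galoisCohomology (ρ.tateDual n) 2 :=
  haveI := moduleFinite_presModule₁ ρ
  haveI := moduleFinite_presModule₂ ρ
  haveI := absoluteGaloisGroup_compactSpace K
  (cohomologyMap (tateDualUnitsIso K ρ n hM).inv 2).hom.toLinearMap.toAddMonoidHom.comp
    ((dual_pres_isSES ρ).δ₁.toAddMonoidHom.comp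
      ((hom_idele_isSES ρ).δ₀.toAddMonoidHom.comp
        (homInvariantHom (presentationComplex ρ).X₁ (classBarD K))))

/-- Unfolding `shaTwoConnecting`. [cite: MilneADT2006, I Thm. 4.10 (proof, p. 58)] -/
theorem shaTwoConnecting_apply (h : (presentationComplex ρ).X₁ ⟶ classBarD K) :
    shaTwoConnecting ρ n hM h =
      haveI := moduleFinite_presModule₁ ρ
      haveI := moduleFinite_presModule₂ ρ
      haveI := absoluteGaloisGroup_compactSpace K
      cohomologyMap (tateDualUnitsIso K ρ n hM).inv 2
        ((dual_pres_isSES ρ).δ₁ ((hom_idele_isSES ρ).δ₀ (homInvariant (presentationComplex ρ).X₁ (classBarD K) h))) := rfl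

/-- **(a) `Ψ(f ≫ g) = 0`**: a homomorphism `N₁ → C̄` that lifts EQUIVARIANTLY to `J̄` has `δ₀ = 0`.
[cite: MilneADT2006, I Thm. 4.10 (proof, p. 58)][cite: SerreGaloisCohomology1997, I §2.2] -/
theorem shaTwoConnecting_comp_g' (f : (presentationComplex ρ).X₁ ⟶ ideleBarD K) :
    shaTwoConnecting ρ n hM (f ≫ (ideleClassSeq K).g) = 0 := by
  haveI := moduleFinite_presModule₁ ρ
  haveI := moduleFinite_presModule₂ ρ
  haveI := absoluteGaloisGroup_compactSpace K
  rw [shaTwoConnecting_apply]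
  have h0 : (hom_idele_isSES ρ).δ₀ (homInvariant (presentationComplex ρ).X₁ (classBarD K) (f ≫ (ideleClassSeq K).g)) = 0 := by
    rw [IsSES.δ₀_eq_zero_iff]
    exact ⟨(homInvariant (presentationComplex ρ).X₁ (ideleBarD K) f).1,
      (homInvariant (presentationComplex ρ).X₁ (ideleBarD K) f).2, LinearMap.ext fun _ => rfl⟩
  rw [h0, map_zero, map_zero]
  rfl

/-- **(b) `Ψ(ι ≫ q) = 0`**: a homomorphism `N₁ → C̄` that extends to `P` has no obstruction — `δ₀` is natural under the
morphism `Hom(P, T) → Hom(N₁, T)` of short exact sequences (precomposition with `ι : N₁ → P`), whose first component is the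
map `ι^* : Hom(P, K̄ˣ) → Hom(N₁, K̄ˣ)` of the dual sequence `Hom(S, K̄ˣ)`, and `δ₁ ∘ H¹(ι^*) = 0`.
[cite: MilneADT2006, I Thm. 4.10 (proof, p. 58)][cite: NeukirchSchmidtWingberg2008, (1.3.3)] -/
theorem shaTwoConnecting_f_comp (q : (presentationComplex ρ).X₂ ⟶ classBarD K) :
    shaTwoConnecting ρ n hM ((presentationComplex ρ).f ≫ q) = 0 := by
  haveI := moduleFinite_presModule₁ ρ
  haveI := moduleFinite_presModule₂ ρ
  haveI := absoluteGaloisGroup_compactSpace K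
  rw [shaTwoConnecting_apply]
  have e := IsSES.cohomologyMap_δ₀ (hom_idele_isSES₂ ρ) (hom_idele_isSES ρ)
    (φ₁ := dualG (presModule₁ ρ) (presModule₂ ρ) (units K) (presIncl ρ))
    (φ₂ := toTopRepHom _ _ (precomp (presModule₁ ρ) (presModule₂ ρ) (toDGM (ideleBarD K)) (presIncl ρ)))
    (φ₃ := toTopRepHom _ _ (precomp (presModule₁ ρ) (presModule₂ ρ) (toDGM (classBarD K)) (presIncl ρ)))
    (fun _ => rfl) (fun _ => rfl) (homInvariant (presentationComplex ρ).X₂ (classBarD K) q)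
  have e' : (hom_idele_isSES ρ).δ₀ (homInvariant (presentationComplex ρ).X₁ (classBarD K) ((presentationComplex ρ).f ≫ q)) =
      cohomologyMap (dualG (presModule₁ ρ) (presModule₂ ρ) (units K) (presIncl ρ)) 1
        ((hom_idele_isSES₂ ρ).δ₀ (homInvariant (presentationComplex ρ).X₂ (classBarD K) q)) := e.symm
  rw [e', (dual_pres_isSES ρ).δ₁_map_one, map_zero]
  rfl

omit [NumberField K] in
/-- `H²(e⁻¹)` is injective (it is induced by an isomorphism of coefficients). [cite: MilneADT2006, I §0, I §2] -/
theorem cohomologyMap_tateDualUnitsIso_inv_injective (q : ℕ) :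
    Function.Injective (cohomologyMap (tateDualUnitsIso K ρ n hM).inv q) :=
  (continuousCohomologyEquivOfIso (tateDualUnitsIso K ρ n hM).symm q).injective

/-- **(c) `Ψ h = 0 ⟹ h` lifts to `J̄`**: `δ₁(δ₀ h) = 0` puts `δ₀ h` in the image of `H¹(K, Hom(P, K̄ˣ)) = 0` (Hilbert 90 at
the layers + Shapiro for the permutation module `P`, door-c6 `HomPermutation.galoisCohomology_hom_units_eq_zero`), so
`δ₀ h = 0` and `h = f ≫ g` for an EQUIVARIANT `f : N₁ → J̄` (exactness of `δ₀`; the equivariant additive `f` is a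
`C_Γ`-morphism). [cite: MilneADT2006, I Thm. 4.10 (proof, p. 58), Lemma 4.13 (proof)][cite: SerreGaloisCohomology1997, I §2.2] -/
theorem exists_comp_g_eq_of_shaTwoConnecting_eq_zero (h : (presentationComplex ρ).X₁ ⟶ classBarD K)
    (h0 : shaTwoConnecting ρ n hM h = 0) :
    ∃ f : (presentationComplex ρ).X₁ ⟶ (ideleClassLimitShortComplex K).X₂, h = f ≫ (ideleClassLimitShortComplex K).g := by
  haveI := moduleFinite_presModule₁ ρ
  haveI := moduleFinite_presModule₂ ρ
  haveI := absoluteGaloisGroup_compactSpace K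
  haveI := (presentationLayer ρ).finiteDimensional
  haveI := (presentationLayer ρ).isGalois
  rw [shaTwoConnecting_apply] at h0
  have h1 := (map_eq_zero_iff _ (cohomologyMap_tateDualUnitsIso_inv_injective ρ n hM 2)).1 h0
  obtain ⟨y, hy⟩ := (dual_pres_isSES ρ).exists_map_one_eq_of_δ₁_eq_zero _ h1
  have hy0 : y = 0 := galoisCohomology_hom_units_eq_zero (uniformIsotropy_presIndex ρ) (permutedBasis_presModule₂ ρ) y
  rw [hy0, map_zero] at hy
  obtain ⟨w, hw, hwv⟩ := ((hom_idele_isSES ρ).δ₀_eq_zero_iff _).1 hy.symm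
  refine ⟨homOfEquivariant (presentationComplex ρ).X₁ (ideleBarD K)
    (show LCarrier (presentationComplex ρ).X₁ →ₗ[ℤ] LCarrier (ideleBarD K) from w).toAddMonoidHom
    (fun σ x => (mem_invariants_iff _ _ w).1 hw σ x), ?_⟩
  refine ObjectProperty.hom_ext _ (Rep.hom_ext (DFunLike.ext _ _ fun x => ?_))
  have hx := LinearMap.congr_fun hwv (LCarrier.of (presentationComplex ρ).X₁ x)
  exact hx.symm

end Obstruction

/-! ## §5 Property (d): `Ψ h` is locally trivial at every place carrying an idèle projection -/

section Local

variable {K : Type} [Field K] [NumberField K]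
variable {M : Type} [AddCommGroup M] [TopologicalSpace M] [DiscreteTopology M] [Finite M]
variable (ρ : DiscreteGaloisModule K M) (n : ℕ) [NeZero n] (hM : ∀ m : M, n • m = 0)

/-- **An idèle projection `π_v : J̄ → K̄_vˣ` as a continuous `res_v`-equivariant map of discrete Galois modules**
`J̄|_{Γ_{K_v}} → K̄_vˣ` (on the `toDGM` synonym). [cite: MilneADT2006, I Lemma 4.13 (proof)] -/
def IdeleProjection.toIntertwining {v : Place K} (π : IdeleProjection K v) :
    ((toDGM (ideleBarD K)).restrictField (Place.Completion v)).toContRepresentation →ⁱL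
      (units (Place.Completion v)).toContRepresentation where
  toLinearMap := (π.toAddMonoidHom.comp (LCarrier.val (ideleBarD K))).toIntLinearMap
  cont := continuous_of_discreteTopology
  isIntertwining' σ := by
    refine ContinuousLinearMap.ext fun z => ?_
    exact π.map_rep σ (LCarrier.val (ideleBarD K) z)

/-- Unfolding `IdeleProjection.toIntertwining`. [cite: MilneADT2006, I Lemma 4.13 (proof)] -/
@[simp] theorem IdeleProjection.toIntertwining_apply {v : Place K} (π : IdeleProjection K v) (z : LCarrier (ideleBarD K)) :
    π.toIntertwining z = π.toAddMonoidHom (LCarrier.val (ideleBarD K) z) := rfl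

/-- **(d) `loc_v (Ψ h) = 0` at every place `v` with an idèle projection `π_v : J̄ → K̄_vˣ`.**  Read `loc_v ∘ H²(e⁻¹)` as the
change of group `H²(res_v, ι_v ∘ –)` (through `e_v = tateDualRestrictUnitsIso`, as in door-c6's (R2)); `δ₁` commutes with it
(`IsSES.map_res_δ₁`, landing in the dual sequence of the RESTRICTED presentation over `K_v`), and the transferred class
`H¹(res_v, ι_v ∘ –)(δ₀^{Hom(N₁, T)} h)` VANISHES: post-composition with `π_v` is a `res_v`-equivariant map
`Hom(N₁, J̄) → Hom(N₁|_v, K̄_vˣ)` extending `ι_v ∘ –` (`π_v` is `ι_v` on principal idèles), so the `δ₀`-cocycle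
`σ ↦ ι_v ∘ (σ h̃ − h̃)` is the coboundary of `π_v ∘ h̃` (`IsSES.map_res_δ₀_eq_zero_of_extends`).
[cite: MilneADT2006, I Thm. 4.10 (proof, p. 58), Lemma 4.13 (proof)][cite: NeukirchSchmidtWingberg2008, (1.5.2)] -/
theorem localization_shaTwoConnecting_eq_zero {v : Place K} (π : IdeleProjection K v)
    (h : (presentationComplex ρ).X₁ ⟶ classBarD K) :
    galoisCohomology.localization (ρ.tateDual n) v 2 (shaTwoConnecting ρ n hM h) = 0 := by
  haveI := moduleFinite_presModule₁ ρ
  haveI := moduleFinite_presModule₂ ρ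
  haveI := absoluteGaloisGroup_compactSpace K
  haveI := absoluteGaloisGroup_compactSpace (Place.Completion v)
  haveI : CharZero (Place.Completion v) := charZero_of_algebra (K := K) (Place.Completion v)
  rw [shaTwoConnecting_apply]
  set L := Place.Completion v
  set c := (hom_idele_isSES ρ).δ₀ (homInvariant (presentationComplex ρ).X₁ (classBarD K) h) with hc
  let θ : absoluteGaloisGroup L →ₜ* absoluteGaloisGroup K := absGaloisRestrict K L
  -- `loc_v ∘ H²(e⁻¹) = H²(θ, e⁻¹|)`
  have h1 : galoisCohomology.localization (ρ.tateDual n) v 2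
      (cohomologyMap (tateDualUnitsIso K ρ n hM).inv 2 ((dual_pres_isSES ρ).δ₁ c)) =
      ContinuousCohomology.map θ (resAlongHom θ (tateDualUnitsIso K ρ n hM).inv) 2 ((dual_pres_isSES ρ).δ₁ c) :=
    (map_resAlongHom_eq θ (tateDualUnitsIso K ρ n hM).inv 2 _).symm
  rw [h1]
  -- `H²(e_v) ∘ H²(θ, e⁻¹|) = H²(θ, ι_v ∘ –)`, and `H²(e_v)` is injective
  refine (map_eq_zero_iff _ (cohomologyMap_tateDualRestrictUnitsIso_bijective K L ρ n hM 2).1).1 ?_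
  have h2 : cohomologyMap (tateDualRestrictUnitsIso K L ρ n hM).hom 2
      (ContinuousCohomology.map θ (resAlongHom θ (tateDualUnitsIso K ρ n hM).inv) 2 ((dual_pres_isSES ρ).δ₁ c)) =
      ContinuousCohomology.map θ (postcompResHom ρ (units K) (units L) (unitsTransfer K L)) 2 ((dual_pres_isSES ρ).δ₁ c) :=
    (map_comp_apply_of θ (ContinuousMonoidHom.id _) θ (fun _ => rfl)
      (resAlongHom θ (tateDualUnitsIso K ρ n hM).inv) (resIdHom (tateDualRestrictUnitsIso K L ρ n hM).hom)
      (postcompResHom ρ (units K) (units L) (unitsTransfer K L))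
      (fun F => postcompAddHom_unitsTransfer_eq_restrict L ρ n hM F) 2 ((dual_pres_isSES ρ).δ₁ c)).symm
  rw [h2]
  -- `δ₁` commutes with restriction-and-transfer
  rw [IsSES.map_res_δ₁ θ (postcompResHom ρ (units K) (units L) (unitsTransfer K L))
    (postcompResHom (presModule₂ ρ) (units K) (units L) (unitsTransfer K L))
    (postcompResHom (presModule₁ ρ) (units K) (units L) (unitsTransfer K L)) (dual_pres_isSES ρ)
    (isSES_dual ((presModule₁ ρ).restrictField L) ((presModule₂ ρ).restrictField L) (ρ.restrictField L) (units L)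
      (restrictIntertwining (presModule₁ ρ) (presModule₂ ρ) (presIncl ρ)) (restrictIntertwining (presModule₂ ρ) ρ (presProj ρ))
      (isSES_restrict (presModule₁ ρ) (presModule₂ ρ) ρ (pres_isSES ρ)) (baer_unitsCarrier L))
    (fun _ => rfl) (fun _ => rfl) c]
  -- the transferred `δ₀`-class vanishes: `π_v ∘ –` extends `ι_v ∘ –` over `Hom(N₁, J̄)`
  have h4 : ContinuousCohomology.map θ (postcompResHom (presModule₁ ρ) (units K) (units L) (unitsTransfer K L)) 1 c = 0 := by
    rw [hc]
    refine IsSES.map_res_δ₀_eq_zero_of_extends θ (postcompResHom (presModule₁ ρ) (units K) (units L) (unitsTransfer K L))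
      (hom_idele_isSES ρ) (postcompResHom (presModule₁ ρ) (toDGM (ideleBarD K)) (units L) π.toIntertwining) (fun F => ?_) _
    refine LinearMap.ext fun x => ?_
    change π.toAddMonoidHom ((unitsToIdele K).limitMap ((unitsBarAddEquiv K).symm
      ((show LCarrier (presentationComplex ρ).X₁ →ₗ[ℤ] UnitsCarrier K from F) x))) =
      unitsTransfer K L ((show LCarrier (presentationComplex ρ).X₁ →ₗ[ℤ] UnitsCarrier K from F) x)
    rw [π.map_unitsToIdele, AddEquiv.apply_symm_apply, unitsTransfer_apply]
  rw [h4, map_zero]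
  rfl

/-- **(d) `Ψ h ∈ Ш²(K, M^D)`** for every `h : N₁ ⟶ C̄`, given idèle projections at ALL places (real places included:
nothing is special about `K_v = ℝ`). [cite: MilneADT2006, I Thm. 4.10 (proof, p. 58)] -/
theorem shaTwoConnecting_mem_shaTwo (π : ∀ v : Place K, IdeleProjection K v)
    (h : (presentationComplex ρ).X₁ ⟶ classBarD K) : shaTwoConnecting ρ n hM h ∈ shaTwo (ρ.tateDual n) := by
  rw [mem_shaTwo_iff]
  exact fun v => localization_shaTwoConnecting_eq_zero ρ n hM (π v) h

end Local

end HomDual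

end Literature.NumberTheory.GaloisRepresentations

end
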